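import Literature.AlgebraicGeometry.Frobenioids.PadicFrobenioidPerfection
import Literature.AlgebraicGeometry.Frobenioids.ModelFrobenioidMap
import HarnessLib

/-!
# Frobenioids II, Example 1.1 (ii): inclusions of subfunctor data and the functor `C^⊢ → C` ([IUTchI] Ex. 3.3 (i))

Mochizuki, *The geometry of Frobenioids II*, Kyushu J. Math. **62** (2008) 401–460, §1, Example 1.1 (ii), p. 8
[cite: MochizukiFrdII2008, Ex 1.1 (ii) p.8]; [IUTchI] Ex. 3.2 (v) / 3.3 (i): "`Φ_{C_v^⊢} … ⊆ Φ_{C_v}|_{D_v^⊢}` …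
these monoids `Φ_{C_v^⊢}`, `Φ_{C_v}` determine `p_v`-adic Frobenioids `C_v^⊢ ⊆ C_v` [cf. [FrdII], Example 1.1, (ii)]
… which may be thought of as a subcategory of `C_v`".

For two subfunctor data `T ≤ T'` (`PadicFrobenioidSubfunctor.lean`, abc-iut-L1-t4) over the same base — i.e.
`Φ_T(A) ⊆ Φ_{T'}(A)` inside `Φ₀(A)` for all `A` — the inclusion is a morphism of model data
`(Φ_T, B_T, Div) → (Φ_{T'}, B_{T'}, Div)` (abc-iut-L1-t5's `ModelFrobenioid.DataHom`: `η` = the inclusion,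
`β(x, γ) = (x, η^gp γ)`), whence ([FrdI] Prop. 5.3, t5's `DataHom.functor`) a functor of model Frobenioids:

* `SubDatum.inclusion T T' h : DataHom (T.toDatum …).divB (T'.toDatum …).divB`, `SubDatum.inclusionFunctor`;
* `primSubDatum base hloc` — the absolutely primitive datum as a `SubDatum` (`primSubDatum_toDatum : … =
  Datum.prim …` by `rfl`), `primSubDatum_le_perfSubDatum`;
* **`Datum.primToPerf`, `Datum.primToPerfFunctor : C^⊢ ⥤ C`** — the functor `C_v^⊢ → C_v` of [IUTchI] Ex. 3.3 (i)
  over a base of `p_v`-adic local fields.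
-/

noncomputable section

namespace Literature.AlgebraicGeometry.Frobenioids

namespace PadicFrd

open CategoryTheory Opposite Function

universe v u

variable {D : Type u} [Category.{v} D] {p : ℕ} {base : D ⥤ PadicFld.{u} p}

namespace SubDatum

variable (T T' : SubDatum base) (h : ∀ A : D, T.S A ≤ T'.S A)

/-- The inclusion `η : Φ_T ↪ Φ_{T'}` of subfunctors of `Φ₀|_D`. [cite: MochizukiFrdII2008, Ex 1.1 (ii) p.8] -/
def inclusionη : T.Φ ⟶ T'.Φ where
  app A := CommMonCat.ofHom (Submonoid.inclusion (h A.unop))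
  naturality {A A'} f := by
    apply CommMonCat.hom_ext
    exact MonoidHom.ext fun x => rfl

/-- `ι_{T'} ∘ η = ι_T`. [cite: MochizukiFrdII2008, Ex 1.1 (ii) p.8] -/
theorem inclusionη_ι (A : Dᵒᵖ) : (T.inclusionη T' h).app A ≫ T'.ι.app A = T.ι.app A := by
  apply CommMonCat.hom_ext
  exact MonoidHom.ext fun x => rfl

/-- The map `β_A : B_T(A) → B_{T'}(A)`, `(x, γ) ↦ (x, η^gp γ)` (well defined since `ι_{T'}^gp ∘ η^gp = ι_T^gp`).
[cite: MochizukiFrdII2008, Ex 1.1 (ii) p.8] -/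
def inclusionβMap (A : Dᵒᵖ) : T.BSub A →* T'.BSub A :=
  ((MonoidHom.prodMap (MonoidHom.id _) (gpApp (T.inclusionη T' h) A)).comp (Submonoid.subtype _)).codRestrict _
    fun q => by
    obtain ⟨⟨x, γ⟩, hq⟩ := q
    have hq' : ((divZeroOn base).app A).hom x = MonGp.map (T.ι.app A).hom γ := hq
    show ((divZeroOn base).app A).hom x = MonGp.map (T'.ι.app A).hom (MonGp.map ((T.inclusionη T' h).app A).hom γ)
    rw [hq', ← MonoidHom.comp_apply, ← MonGp.map_comp, ← CommMonCat.hom_comp, inclusionη_ι]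

/-- `β : B_T → B_{T'}` as a natural transformation. [cite: MochizukiFrdII2008, Ex 1.1 (ii) p.8] -/
def inclusionβ : T.B ⟶ T'.B where
  app A := CommMonCat.ofHom (T.inclusionβMap T' h A)
  naturality {A A'} f := by
    apply CommMonCat.hom_ext
    refine MonoidHom.ext fun q => Subtype.ext (Prod.ext rfl ?_)
    show gpApp (T.inclusionη T' h) A' (((monoidGp T.Φ).map f).hom q.1.2) =
      ((monoidGp T'.Φ).map f).hom (gpApp (T.inclusionη T' h) A q.1.2)
    have key := congrArg (fun φ => φ.hom q.1.2)
      ((Functor.whiskerRight (T.inclusionη T' h) MonGp.functor).naturality f)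
    simp only [CommMonCat.hom_comp, MonoidHom.comp_apply] at key
    exact key

section PadicLocal

variable [Fact p.Prime] (hloc : ∀ A : D, (base.obj A).IsPadicLocal) (hc : IsConnected D) (he : IsTotallyEpimorphic D)

/-- **The inclusion `T ≤ T'` as a morphism of model data** `(Φ_T, B_T, Div) → (Φ_{T'}, B_{T'}, Div)`
(`η` = inclusion, `β(x, γ) = (x, η^gp γ)`; `Div ∘ β = η^gp ∘ Div` by construction).
[cite: MochizukiFrdII2008, Ex 1.1 (ii) p.8] -/
def inclusion : ModelFrobenioid.DataHom (T.toDatum hloc hc he).divB (T'.toDatum hloc hc he).divB where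
  η := T.inclusionη T' h
  β := T.inclusionβ T' h
  comm _ _ := rfl

/-- **The induced functor of model Frobenioids `C_T ⥤ C_{T'}`** ([FrdI] Prop. 5.3 via abc-iut-L1-t5's
`DataHom.functor`). [cite: MochizukiFrdII2008, Ex 1.1 (ii) p.8] -/
def inclusionFunctor : (T.toDatum hloc hc he).frobenioid ⥤ (T'.toDatum hloc hc he).frobenioid :=
  (T.inclusion T' h hloc hc he).functor

/-- The induced functor is the identity on base objects. [cite: MochizukiFrdII2008, Ex 1.1 (ii) p.8] -/
@[simp] theorem inclusionFunctor_obj_base (X : (T.toDatum hloc hc he).frobenioid) :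
    ((T.inclusionFunctor T' h hloc hc he).obj X).base = X.base := rfl

/-- The induced functor is faithful (`β_A` is injective: it is the identity on the `K^×`-component, which
determines an element of `B`). [cite: MochizukiFrdII2008, Ex 1.1 (ii) p.8] -/
theorem inclusionFunctor_faithful : (T.inclusionFunctor T' h hloc hc he).Faithful := by
  refine ⟨fun {X Y} φ ψ hφψ => ?_⟩
  let F := T.inclusionFunctor T' h hloc hc he
  have hd : ModelFrobenioid.Hom.degFr φ = ModelFrobenioid.Hom.degFr ψ :=
    congrArg (fun χ : F.obj X ⟶ F.obj Y => ModelFrobenioid.Hom.degFr χ) hφψ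
  have hb : ModelFrobenioid.Hom.base φ = ModelFrobenioid.Hom.base ψ :=
    congrArg (fun χ : F.obj X ⟶ F.obj Y => ModelFrobenioid.Hom.base χ) hφψ
  have hdiv : ((T.inclusionη T' h).app (op X.base)).hom (ModelFrobenioid.Hom.div φ) =
      ((T.inclusionη T' h).app (op X.base)).hom (ModelFrobenioid.Hom.div ψ) :=
    congrArg (fun χ : F.obj X ⟶ F.obj Y => ModelFrobenioid.Hom.div χ) hφψ
  have hunit : T.inclusionβMap T' h (op X.base) (ModelFrobenioid.Hom.unit φ) =
      T.inclusionβMap T' h (op X.base) (ModelFrobenioid.Hom.unit ψ) :=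
    congrArg (fun χ : F.obj X ⟶ F.obj Y => ModelFrobenioid.Hom.unit χ) hφψ
  apply ModelFrobenioid.hom_ext
  · exact hd
  · exact hb
  · have hdiv' := congrArg Subtype.val hdiv
    exact Subtype.ext hdiv'
  · haveI : IsCancelMul ((phiZeroOn base).obj (op X.base)) := isCancelMul_realification (OrdInt (base.obj X.base).K)
    have h1 : (ModelFrobenioid.Hom.unit φ).1.1 = (ModelFrobenioid.Hom.unit ψ).1.1 :=
      congrArg (fun q : T'.BSub (op X.base) => q.1.1) hunit
    have hι : Injective (MonGp.map (T.ι.app (op X.base)).hom) := MonGp.map_injective _ (T.ι_injective _)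
    refine Subtype.ext (Prod.ext h1 (hι ?_))
    have hφ : ((divZeroOn base).app (op X.base)).hom (ModelFrobenioid.Hom.unit φ).1.1 =
        MonGp.map (T.ι.app (op X.base)).hom (ModelFrobenioid.Hom.unit φ).1.2 := (ModelFrobenioid.Hom.unit φ).2
    have hψ : ((divZeroOn base).app (op X.base)).hom (ModelFrobenioid.Hom.unit ψ).1.1 =
        MonGp.map (T.ι.app (op X.base)).hom (ModelFrobenioid.Hom.unit ψ).1.2 := (ModelFrobenioid.Hom.unit ψ).2
    rw [← hφ, ← hψ, h1]

end PadicLocal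

end SubDatum

/-! ### `C^⊢ ⥤ C`: the absolutely primitive datum inside the perfection -/

section Prim

variable [Fact p.Prime] (base) (hloc : ∀ A : D, (base.obj A).IsPadicLocal) (hc : IsConnected D) (he : IsTotallyEpimorphic D)

/-- The absolutely primitive datum `Φ^⊢ = ℤ_{≥0} · ord(p)` as a `SubDatum`. [cite: MochizukiFrdII2008, Ex 1.1 (ii) p.8] -/
def primSubDatum : SubDatum base where
  S A := Submonoid.powers (primGen base A)
  map_mem f x hx := by
    obtain ⟨n, rfl⟩ := hx
    exact ⟨n, by rw [map_pow, phi0Map_primGen]⟩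
  isMonoprime A := by
    classical
    exact IsMonoprime.ofZ ⟨⟨(Submonoid.powLogEquiv (primGen_pow_injective base (hloc A))).symm⟩⟩
  g A := ⟨((p : ℕ) : (base.obj A).K), (base.obj A).p_mem⟩
  g_mem A := Submonoid.mem_powers _
  g_not_isUnit A h := (base.obj A).p_lt.ne ((isUnit_intNonzero_iff _ _).mp h)

/-- Its datum IS `Datum.prim` (definitionally). [cite: MochizukiFrdII2008, Ex 1.1 (ii) p.8] -/
theorem primSubDatum_toDatum : (primSubDatum base hloc).toDatum hloc hc he = Datum.prim base hloc hc he := rfl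

/-- `Φ^⊢ ⊆ ord(O^⊳)^pf` objectwise ("`Φ_{C_v^⊢} ⊆ Φ_{C_v}|_{D_v^⊢}`"). [cite: MochizukiFrdII2008, Ex 1.1 (ii) p.8] -/
theorem primSubDatum_le_perfSubDatum (A : D) : (primSubDatum base hloc).S A ≤ (perfSubDatum base hloc).S A :=
  Datum.prim_Φ_le_perf base A

/-- **The morphism of model data `(Φ^⊢, B^⊢) → (ord(O^⊳)^pf, B^pf)`** underlying `C^⊢ ⊆ C`.
[cite: MochizukiFrdII2008, Ex 1.1 (ii) p.8] -/
def Datum.primToPerf :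
    ModelFrobenioid.DataHom (Datum.prim base hloc hc he).divB (Datum.perf base hloc hc he).divB :=
  (primSubDatum base hloc).inclusion (perfSubDatum base hloc) (primSubDatum_le_perfSubDatum base hloc) hloc hc he

/-- **The functor `C^⊢ ⥤ C`** ("`C_v^⊢ ⊆ C_v` … may be thought of as a subcategory of `C_v`", [IUTchI] Ex. 3.2 (v) /
3.3 (i)), the identity on base objects and faithful. [cite: MochizukiFrdII2008, Ex 1.1 (ii) p.8] -/
def Datum.primToPerfFunctor : (Datum.prim base hloc hc he).frobenioid ⥤ (Datum.perf base hloc hc he).frobenioid :=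
  (Datum.primToPerf base hloc hc he).functor

/-- `C^⊢ ⥤ C` is faithful. [cite: MochizukiFrdII2008, Ex 1.1 (ii) p.8] -/
theorem Datum.primToPerfFunctor_faithful : (Datum.primToPerfFunctor base hloc hc he).Faithful :=
  (primSubDatum base hloc).inclusionFunctor_faithful (perfSubDatum base hloc) (primSubDatum_le_perfSubDatum base hloc)
    hloc hc he

end Prim

end PadicFrd

end Literature.AlgebraicGeometry.Frobenioids
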